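import Mathlib.Order.Closure
import Mathlib.MeasureTheory.Constructions.Pi
import Mathlib.Analysis.SpecialFunctions.Log.Basic
import Mathlib.Algebra.BigOperators.Finprod
import Mathlib.Analysis.Normed.Module.Ball.Pointwise
import Literature.IUT.LogThetaLattice.PacketWeights
import Literature.IUT.LogThetaLattice.PacketLogVolumes
import Literature.IUT.LogThetaLattice.HolomorphicHull
import Literature.IUT.LogVolume.LogVolume
import Literature.IUT.LogVolume.HolomorphicHull
import HarnessLib

/-!
# The fork at [IUTchIII] Corollary 3.12 — the Corollary's container nouns over the REAL tensor-packet declarations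

Record-only file (D-0012) of the abc-iut cell (Cor. 3.12 sub-crew, wave 2, seat abc-iut-c312-6); TAKES NO SIDE.
The fork skeleton states Corollary 3.12 one level below the reals over an INTERFACE
(`ForkRegions.VolumeContainer`: a carrier `𝕃`, admissible regions, a monotone log-volume `ln ν̄`, the holomorphic
hull as a closure operator; `Cor312Setting`: the possible images `U_λ` of the Θ-pilot object and the image `Q`
of the `q`-pilot object). This file supplies those four fields from the declarations the layer-L6 / campaign-S
typers landed for the nouns the Corollary quotes — so that the VERBATIM form (seat c312-7, over [IUTchIII]
Def. 3.8 / Prop. 3.9 / Rmk. 3.9.5 / Thm. 3.11) and the Dupuy–Hilado form (seat c312-3, over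
`Literature.IUT.LogVolume`) meet in ONE kernel object, and records the identifications between the two sides:

* §1 `Adm m`, `logvol m c`: admissibility (= finite nonzero measure) and the log-volume `c · log m(A)` of a
  monotone `ℝ≥0∞`-valued set function `m`; `logvol_mono` (the container axiom `logvol_mono`, PROVED once).
* §2 VERBATIM local log-volume at one `v_ℚ` and one capsule index set `A` ([IUTchIII] Rmk. 3.1.1 (iii)/(iv)
  p. 95–97: "weighted sums of log-volumes … may be computed for, say, arbitrary Borel sets by applying the
  elementary construction discussed in (iv)", "the result of multiplying the [natural] logarithm of the
  `E`-weighted measure `μ_E(−)` of (iv) by a suitable normalization factor yields the weighted sums of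
  log-volumes discussed in (ii)"): `packetLogvolE E M μ D := (1/(N_E·D)) · log μ_E(−)` over abc-iut-L6-t4's
  `LogThetaLattice.weightedMeasure` (p403744), with `D = Σ_{{w_α}} Π_α [(F_mod)_{w_α} : ℚ_{v_ℚ}]` the second factor
  of the normalized weight of Rmk. 3.1.1 (ii); `weightedMeasure_mono`; and `packetLogvolE_directProduct`: on a
  direct product region it IS L6-t4's `packetLogVolume` (Prop. 3.9 (i), p404053) with the normalized weights —
  by L6-t4's `weightedMeasure_log_directProduct` (the displayed formula of Rmk. 3.1.1 (iv)).
* §3 DH/S side: the same `logvol` over abc-iut-S2's `IntegralStructure.haar` IS S2's `normalizedLogVolume`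
  ([IUTchIV] Prop. 1.4 (i); DH §3.4 `log μ̄_W(Ω) := log μ_W(Ω)/dim W`; p404069), and L6-t4's `packetLogVolume`
  over Haar measures is the weighted sum of S2's `logVolume`s (`packetLogVolume_haar`).
* §4 the HULL: S2's `LogVolume.hullClosureOperator` (p404153; total, norm presentation, archimedean or not) is
  the container's closure operator; `isHullSet_iff_logVolume` / `holomorphicHull_eq_logVolume`: on a product of
  nonarchimedean local fields with `𝒪 =` closed unit balls it agrees with L6-t4's VERBATIM
  `LogThetaLattice.holomorphicHull` (Rmk. 3.9.5 (i), p404101) on every region that is unbounded or nondegenerate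
  (the printed proviso "contains a relatively compact subset whose log-volume is finite").
* §5 assembling labels `j ∈ 𝔽_l^⋇` and places `v_ℚ ∈ 𝕍_ℚ`: `boxHull` (componentwise hull of a region of
  `Π_t 𝕃_t`, a `ClosureOperator`), `aggLogvol c lv` (`Σᶠ_t c_t · lv_t(pr_t −)` on boxes) with `aggLogvol_mono`, and
  `aggLogvol_eq_processionNormalized`: for `t = (j, v_ℚ)`, `c_t = 1/l⋇` it IS L6-t4's
  `processionNormalized (j ↦ globalLogVolume …)` (Prop. 3.9 (i) "average over `j`", (iii) "adding the
  log-volumes … at the various `v_ℚ`") — the "procession-normalized mono-analytic log-volume" of Cor. 3.12 BY NAME.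

Every constant resolves to a landed `Literature.IUT.*` declaration or Mathlib; no local placeholder structure.
RESIDUAL (placeholder → owner, for the c312 04:30Z list): the measure spaces `M_v` at ARCHIMEDEAN `v_ℚ` are the
"radial portion" of `⊗ ℂ` (Rmk. 3.1.1 (iii) p. 96) — enters here as an abstract measure space (owner: abc-iut-L4-t2,
[AbsTopIII] Prop. 5.7 (ii) radial log-volume); the instantiation `μ_v = ` Haar of `⊗_α K_{v_α}` decomposed as
`⊕ fields` is abc-iut-S1's ring `R_I` ([IUTchIV] Prop. 1.1–1.3); the possible images `U_λ` and the `q`-image `Q`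
are parameters (owner: c312-7 `Cor312Statement`, from Def. 3.8 (i) `thetaPilotObject`/`qPilotObject` + Thm. 3.11);
the `VolumeContainer`/`Cor312Setting` records themselves are assembled in the sequel `Cor312Bridge.lean` once
skel `ForkRegions` (wave 3) is in the tree.

Sources read on the page: [IUTchIII] kurims May-2020 manuscript `paper:url-4b091feeb646` pp. 93–97 (Rmk. 3.1.1),
115–117 (Prop. 3.9), 126–127 (Rmk. 3.9.5 (i)), 173–174 (Cor. 3.12); Dupuy–Hilado arXiv:2004.13228 §1 pp. 3–4,
§3.4. [claim: Mochizuki2012, status: disputed] [cite: DupuyHilado2025, §1 pp. 3–4]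
Deliberately NOT here: the possible images (Θ-pilot object, (Ind1)(Ind2)(Ind3)), the statement of Cor. 3.12
(c312-7), any DH definition (c312-3), any judgement.
-/

noncomputable section

open Set MeasureTheory
open scoped ENNReal

namespace Summit.ABC

namespace IUTFork

namespace Cor312Vol

/-! ## 1. Admissibility and log-volume of a monotone `ℝ≥0∞`-valued set function -/

section LogVol

variable {L : Type*}

/-- ADMISSIBLE regions for a set function `m : Set 𝕃 → ℝ≥0∞`: those of finite NONZERO `m`-measure — the
regions on which `log m(−)` is a real number ([IUTchIII] Rmk. 3.1.1 (iii) p. 95: "compact subsets of positive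
measure"; Dupuy–Hilado §1 p. 4: "`𝕃` is equipped with a collection of subsets `N(𝕃)` and a map `ln ν̄`").
[folklore] -/
@[folklore] def Adm (m : Set L → ℝ≥0∞) (A : Set L) : Prop := m A ≠ 0 ∧ m A ≠ ∞

/-- The LOG-VOLUME `c · log m(A)` attached to a set function `m` and a normalization factor `c`
([IUTchIII] Rmk. 3.1.1 (iii) p. 96: "the result of multiplying the [natural] logarithm of the `E`-weighted
measure `μ_E(−)` … by a suitable normalization factor [i.e., a suitable positive real number]"; [AbsTopIII]
Prop. 5.7 (i) `μ^log := log μ`). Junk value `c · log 0 = 0` off the admissible regions. [folklore] -/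
def logvol (m : Set L → ℝ≥0∞) (c : ℝ) (A : Set L) : ℝ := c * Real.log (m A).toReal

/-- **The container axiom `logvol_mono`, PROVED**: for a monotone set function and a nonnegative factor,
the log-volume is monotone under inclusion of admissible regions. [folklore] -/
theorem logvol_mono {m : Set L → ℝ≥0∞} (hm : ∀ ⦃A B : Set L⦄, A ⊆ B → m A ≤ m B) {c : ℝ} (hc : 0 ≤ c)
    ⦃A B : Set L⦄ (hA : Adm m A) (hB : Adm m B) (hAB : A ⊆ B) : logvol m c A ≤ logvol m c B :=
  mul_le_mul_of_nonneg_left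
    (Real.log_le_log (ENNReal.toReal_pos hA.1 hA.2) (ENNReal.toReal_mono hB.2 (hm hAB))) hc

/-- An admissible region has positive real measure. [folklore] -/
theorem Adm.toReal_pos {m : Set L → ℝ≥0∞} {A : Set L} (hA : Adm m A) : 0 < (m A).toReal :=
  ENNReal.toReal_pos hA.1 hA.2

/-- For a genuine MEASURE, admissibility is upward closed along inclusions into sets of finite measure and
downward closed along inclusions from sets of nonzero measure (used for the possible images). [folklore] -/
theorem Adm.of_subset_of_subset {X : Type*} [MeasurableSpace X] (μ : Measure X) {A B C : Set X}
    (hA : μ A ≠ 0) (hC : μ C ≠ ∞) (hAB : A ⊆ B) (hBC : B ⊆ C) : Adm μ B :=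
  ⟨fun h => hA (measure_mono_null hAB h), (lt_of_le_of_lt (measure_mono hBC) hC.lt_top).ne⟩

end LogVol

/-! ## 2. The VERBATIM local log-volume: `(1/(N_E·D)) · log μ_E(−)` ([IUTchIII] Rmk. 3.1.1 (iv), Prop. 3.9 (i)) -/

section Verbatim

open Literature.IUT.LogThetaLattice

variable {V : Type*} [Fintype V] (E : V → Type*) [∀ v, Fintype (E v)]

/-- `N_E := Π_v N_v`, `N_v = #E_v` ([IUTchIII] Rmk. 3.1.1 (iv) p. 97). [claim: Mochizuki2012, status: disputed] -/
def cardE : ℝ := ∏ v, (Fintype.card (E v) : ℝ)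

/-- `N_E > 0` (the `E_v` are nonempty). [folklore] -/
theorem cardE_pos [∀ v, Nonempty (E v)] : 0 < cardE E :=
  Finset.prod_pos fun v _ => by exact_mod_cast (Fintype.card_pos (α := E v))

variable [DecidableEq V] (M : V → Type*) [∀ v, MeasurableSpace (M v)] (μ : ∀ v, Measure (M v))

/-- The `E`-weighted measure is MONOTONE in the region (it is the product measure of the set `S_E`, which
grows with `S`; [IUTchIII] Rmk. 3.1.1 (iv) p. 97). [folklore] -/
theorem weightedMeasure_mono {S S' : Set (∀ v, M v)} (h : S ⊆ S') :
    weightedMeasure E M μ S ≤ weightedMeasure E M μ S' :=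
  measure_mono fun _ hn e => h (hn e)

/-- **The verbatim local log-volume** on ARBITRARY Borel regions `S ⊆ M_V = Π_v M_v` of the (radial portion
of the) tensor packet at one `v_ℚ ∈ 𝕍_ℚ` and one capsule index set `A`: `μ^log_{A,v_ℚ}(S) := (1/(N_E·D)) · log μ_E(S)`
([IUTchIII] Rmk. 3.1.1 (iii) p. 95 "weighted sums of log-volumes … may be computed for, say, arbitrary Borel
sets by applying the elementary construction discussed in (iv)", (iv) p. 97 `μ_E(S)`; Prop. 3.9 (i) p. 115
"determines log-volumes `μ^log_{A,v_ℚ} : 𝕄(𝓘^ℚ(^A𝓕_{v_ℚ})) → ℝ`"). Here `V = Π_α 𝕍_{v_ℚ}`, `N_v = #E_v =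
Π_α [K_{v_α} : (F_mod)_{v_α}]` (p. 96) and `D = Σ_{{w_α}} Π_α [(F_mod)_{w_α} : ℚ_{v_ℚ}]` is the `v`-independent
factor of the normalized weight of Rmk. 3.1.1 (ii) p. 94, so that the weight of the summand `v` is
`1/(N_v·D) = packetWeightTensor` (`PacketWeights.lean`). [claim: Mochizuki2012, status: disputed] -/
def packetLogvolE (D : ℝ) : Set (∀ v, M v) → ℝ :=
  logvol (weightedMeasure E M μ) (1 / (cardE E * D))

/-- The verbatim local log-volume is monotone on admissible regions (`D > 0`). [folklore] -/
theorem packetLogvolE_mono [∀ v, Nonempty (E v)] {D : ℝ} (hD : 0 < D) ⦃S S' : Set (∀ v, M v)⦄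
    (hS : Adm (weightedMeasure E M μ) S) (hS' : Adm (weightedMeasure E M μ) S') (h : S ⊆ S') :
    packetLogvolE E M μ D S ≤ packetLogvolE E M μ D S' :=
  logvol_mono (fun _ _ hAB => weightedMeasure_mono E M μ hAB)
    (le_of_lt (one_div_pos.mpr (mul_pos (cardE_pos E) hD))) hS hS' h

/-- **On direct product regions the verbatim log-volume IS L6-t4's `packetLogVolume`** with the normalized
weights `w_v = 1/(N_v·D)` ([IUTchIII] Rmk. 3.1.1 (iv) p. 97, displayed formula
`(1/N_E)·μ_E^{log}(S) = Σ_v (1/N_v)·μ_v^{log}(S_v)` = L6-t4's `weightedMeasure_log_directProduct`; Prop. 3.9 (i)).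
[claim: Mochizuki2012, status: disputed] -/
theorem packetLogvolE_directProduct [∀ v, Nonempty (E v)] [∀ v, SigmaFinite (μ v)] (D : ℝ)
    (T : ∀ v, Set (M v)) (hpos : ∀ v, μ v (T v) ≠ 0) (hfin : ∀ v, μ v (T v) ≠ ∞) :
    packetLogvolE E M μ D (Set.univ.pi T) =
      packetLogVolume (fun v => 1 / ((Fintype.card (E v) : ℝ) * D)) μ T := by
  have h := weightedMeasure_log_directProduct (E := E) (M := M) μ T hpos hfin
  have hN : cardE E ≠ 0 := (cardE_pos E).ne'
  unfold packetLogvolE logvol packetLogVolume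
  calc 1 / (cardE E * D) * Real.log (weightedMeasure E M μ (Set.univ.pi T)).toReal
      = (1 / D) * ((1 / ∏ v, (Fintype.card (E v) : ℝ)) *
          Real.log (weightedMeasure E M μ (Set.univ.pi T)).toReal) := by
        unfold cardE; ring
    _ = (1 / D) * ∑ v, (1 / (Fintype.card (E v) : ℝ)) * Real.log (μ v (T v)).toReal := by rw [h]
    _ = ∑ v, 1 / ((Fintype.card (E v) : ℝ) * D) * Real.log (μ v (T v)).toReal := by
        rw [Finset.mul_sum]
        refine Finset.sum_congr rfl fun v _ => ?_
        ring

end Verbatim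

/-! ## 3. The DH/S side: S2's normalized Haar log-volume is the same `logvol` -/

section HaarSide

open Literature.IUT.LogVolume

variable {W : Type*} [AddCommGroup W] [TopologicalSpace W] [IsTopologicalAddGroup W]
  [MeasurableSpace W] [BorelSpace W] (Λ : IntegralStructure W)

/-- S2's normalized log-volume `log μ_Λ(A)/d` ([IUTchIV] Prop. 1.4 (i); Dupuy–Hilado §3.4
`log μ̄_W(Ω) := log μ_W(Ω)/dim W`) IS `logvol μ_Λ (1/d)`. [cite: DupuyHilado2025, §3.4] -/
theorem logvol_haar_eq_normalizedLogVolume (d : ℕ) (A : Set W) :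
    logvol (fun B => Λ.haar B) (1 / (d : ℝ)) A = Λ.normalizedLogVolume d A := by
  unfold logvol IntegralStructure.normalizedLogVolume IntegralStructure.logVolume
  rw [one_div, inv_mul_eq_div]

/-- Monotonicity of S2's normalized log-volume on admissible regions, as an instance of `logvol_mono`
(S2 proves the same as `normalizedLogVolume_mono`). [folklore] -/
theorem normalizedLogVolume_mono_of_adm (d : ℕ) ⦃A B : Set W⦄ (hA : Adm (fun C => Λ.haar C) A)
    (hB : Adm (fun C => Λ.haar C) B) (hAB : A ⊆ B) :
    Λ.normalizedLogVolume d A ≤ Λ.normalizedLogVolume d B := by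
  rw [← logvol_haar_eq_normalizedLogVolume, ← logvol_haar_eq_normalizedLogVolume]
  exact logvol_mono (fun _ _ h => measure_mono h) (by positivity) hA hB hAB

variable {ι : Type*} [Fintype ι] {k : ι → Type*} [∀ i, AddCommGroup (k i)] [∀ i, TopologicalSpace (k i)]
  [∀ i, IsTopologicalAddGroup (k i)] [∀ i, MeasurableSpace (k i)] [∀ i, BorelSpace (k i)]

/-- **Verbatim ↔ S on direct product regions**: L6-t4's `packetLogVolume` ([IUTchIII] Prop. 3.9 (i)) over the
normalized Haar measures `μ_i = μ_{Λ_i}` of S2's integral structures is the weighted sum of S2's log-volumes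
`Σ_i w_i · log μ_{Λ_i}(T_i)` ([AbsTopIII] Prop. 5.7 (i)). [folklore] -/
theorem packetLogVolume_haar (Λs : ∀ i, IntegralStructure (k i)) (w : ι → ℝ) (T : ∀ i, Set (k i)) :
    Literature.IUT.LogThetaLattice.packetLogVolume w (fun i => (Λs i).haar) T =
      ∑ i, w i * (Λs i).logVolume (T i) := rfl

end HaarSide

/-! ## 4. The holomorphic hull: S2's closure operator, and its agreement with the VERBATIM hull (Rmk. 3.9.5 (i)) -/

section HullSide

open Literature.IUT Metric Bornology
open scoped Pointwise

/-- Scaling the closed unit ball of a normed field by `c`: `c·𝒪 = {‖x‖ ≤ ‖c‖}` ("subsets of the form `λ·𝒪`",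
[IUTchIII] Rmk. 3.9.5 (i) p. 127). [folklore] -/
theorem image_mul_closedBall_zero_one {𝕜 : Type*} [NormedField 𝕜] (c : 𝕜) :
    (fun x => c * x) '' closedBall (0 : 𝕜) 1 = closedBall 0 ‖c‖ := by
  rw [← smul_unitClosedBall c, ← Set.image_smul]
  rfl

variable {J : Type*} (K : J → Type*) [∀ j, NontriviallyNormedField (K j)]
variable (O : ∀ j, Subring (K j))

/-- **Verbatim hull-sets = S2's hull sets.** With the integral structures `𝒪_{k_j}` = the closed unit balls
(nonarchimedean local fields, [IUTchIII] Prop. 3.1 (ii) / Rmk. 3.9.1 (i)), L6-t4's `LogThetaLattice.IsHullSet`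
("`λ·𝒪`, each component of `λ` nonzero", Rmk. 3.9.5 (i) p. 127) is S2's `LogVolume.IsHullSet` (polydiscs of
radii `‖λ_j‖`). [claim: Mochizuki2012, status: disputed] -/
theorem isHullSet_iff_logVolume (hO : ∀ j, (O j : Set (K j)) = closedBall (0 : K j) 1) (H : Set (∀ j, K j)) :
    LogThetaLattice.IsHullSet O H ↔ LogVolume.IsHullSet K H := by
  have key : ∀ c : ∀ j, K j,
      (Set.univ.pi fun j => (fun x => c j * x) '' (O j : Set (K j))) = LogVolume.hullSet K c := by
    intro c
    unfold LogVolume.hullSet LogVolume.polydisc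
    congr 1
    funext j
    rw [hO j, image_mul_closedBall_zero_one]
  constructor
  · rintro ⟨c, hc, rfl⟩
    exact ⟨c, hc, key c⟩
  · rintro ⟨c, hc, rfl⟩
    exact ⟨c, hc, (key c).symm⟩

variable [Fintype J] [∀ j, IsUltrametricDist (K j)] [∀ j, ProperSpace (K j)]

/-- **The verbatim holomorphic hull = S2's holomorphic hull** on every region that is unbounded or
nondegenerate ([IUTchIII] Rmk. 3.9.5 (i) p. 127: "If `U` is relatively compact, then we define the holomorphic
hull of `U` to be the smallest subset of the form `λ·𝒪_{(−)}` … that contains `U`. If `U` is not relatively compact,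
then we define the holomorphic hull of `U` to be `𝓘^ℚ((−))`", for `U` that "contains a relatively compact subset
whose log-volume is finite" = nondegenerate): L6-t4's `holomorphicHull O` (intersection of all hull-sets
containing `U`) and S2's `holomorphicHull K` (polydisc of the radii `sup_{u∈U} ‖u_j‖`) coincide — by S2's
`holomorphicHull_eq_sInter` and `isBounded_iff_isCompact_closure`. TODO(general form): bounded degenerate `U`
(a case the source excludes). [claim: Mochizuki2012, status: disputed] -/
theorem holomorphicHull_eq_logVolume (hO : ∀ j, (O j : Set (K j)) = closedBall (0 : K j) 1) (U : Set (∀ j, K j))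
    (hU : ¬ IsBounded U ∨ LogVolume.IsNondegenerate K U) :
    LogThetaLattice.holomorphicHull O U = LogVolume.holomorphicHull K U := by
  unfold LogThetaLattice.holomorphicHull
  by_cases hb : IsBounded U
  · have hnd : LogVolume.IsNondegenerate K U := hU.resolve_left (not_not.mpr hb)
    rw [if_pos ((LogVolume.isBounded_iff_isCompact_closure K U).mp hb),
      LogVolume.holomorphicHull_eq_sInter K hb hnd]
    congr 1
    ext H
    simp only [Set.mem_setOf_eq, isHullSet_iff_logVolume K O hO]
  · rw [if_neg (fun h => hb ((LogVolume.isBounded_iff_isCompact_closure K U).mpr h)),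
      LogVolume.holomorphicHull_of_not_isBounded K hb]

/-- The container's hull operator is S2's `hullClosureOperator` (extensive (P2), monotone (P3), idempotent (P1)
of Rmk. 3.9.5 (ii) p. 127; total: norm presentation, archimedean or nonarchimedean factors); on the regions of
`holomorphicHull_eq_logVolume` its underlying function is the verbatim hull. [claim: Mochizuki2012, status: disputed] -/
theorem hullClosureOperator_apply_eq_verbatim (hO : ∀ j, (O j : Set (K j)) = closedBall (0 : K j) 1)
    (U : Set (∀ j, K j)) (hU : ¬ IsBounded U ∨ LogVolume.IsNondegenerate K U) :
    LogVolume.hullClosureOperator K U = LogThetaLattice.holomorphicHull O U := by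
  rw [holomorphicHull_eq_logVolume K O hO U hU]
  rfl

end HullSide

/-! ## 5. Assembling labels and places: box hulls and the procession-normalized global log-volume -/

section Assemble

variable {T : Type*} {L : T → Type*}

/-- The COMPONENTWISE ("box") hull of a region of a product carrier `Π_t 𝕃_t` (the hull is formed in each tensor
packet separately: [IUTchIII] Rmk. 3.9.5 (i) is a definition per `𝓘^ℚ((−))`, Prop. 3.9 (iii) assembles over
`v_ℚ ∈ 𝕍_ℚ`; Dupuy–Hilado §1: one "adelic" `𝕃`): `A ↦ Π_t hull_t(pr_t(A))`, a `ClosureOperator`. [folklore] -/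
def boxHull (h : ∀ t, ClosureOperator (Set (L t))) : ClosureOperator (Set (∀ t, L t)) :=
  ClosureOperator.mk₂ (fun A => Set.univ.pi fun t => h t ((fun x : (∀ t, L t) => x t) '' A))
    (fun A x hx => Set.mem_univ_pi.mpr fun t => (h t).le_closure ((fun y : (∀ t, L t) => y t) '' A) ⟨x, hx, rfl⟩)
    (fun _ _ hAB => Set.pi_mono fun t _ =>
      (h t).le_closure_iff.mp ((Set.image_mono hAB).trans Set.eval_image_univ_pi_subset))

/-- `boxHull h A = Π_t hull_t(pr_t A)`. [folklore] -/
theorem boxHull_apply (h : ∀ t, ClosureOperator (Set (L t))) (A : Set (∀ t, L t)) :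
    boxHull h A = Set.univ.pi fun t => h t ((fun x : (∀ t, L t) => x t) '' A) := rfl

/-- The box hull of a box with nonempty factors is the box of the hulls. [folklore] -/
theorem boxHull_pi (h : ∀ t, ClosureOperator (Set (L t))) (S : ∀ t, Set (L t)) (hS : ∀ t, (S t).Nonempty) :
    boxHull h (Set.univ.pi S) = Set.univ.pi fun t => h t (S t) := by
  rw [boxHull_apply]
  congr 1
  funext t
  rw [Set.eval_image_univ_pi (Set.univ_pi_nonempty_iff.mpr hS)]

/-- The AGGREGATED log-volume `Σᶠ_t c_t · lv_t(pr_t A)` of a region of `Π_t 𝕃_t` — for `t = (j, v_ℚ)`, `c_t = 1/l⋇`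
this is the "procession-normalized mono-analytic log-volume" of Cor. 3.12 ([IUTchIII] Prop. 3.9 (i) p. 116
"normalize by taking the average, over the various capsules"; (iii) p. 117 "by adding the log-volumes … [all
but finitely many of which are zero!] at the various `v_ℚ ∈ 𝕍_ℚ`"), see `aggLogvol_pi_eq_processionNormalized`.
[claim: Mochizuki2012, status: disputed] -/
def aggLogvol (c : T → ℝ) (lv : ∀ t, Set (L t) → ℝ) (A : Set (∀ t, L t)) : ℝ :=
  ∑ᶠ t, c t * lv t ((fun x : (∀ t, L t) => x t) '' A)

/-- ADMISSIBLE regions of the assembled container: boxes `Π_t S_t` with nonempty admissible factors and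
finitely supported weighted log-volume ([IUTchIII] Prop. 3.9 (iii) p. 117: "the subset … of elements whose
components … have zero log-volume for all but finitely many `v_ℚ`"; Rmk. 3.1.1 (iii): "direct product regions").
[claim: Mochizuki2012, status: disputed] -/
@[claim "Mochizuki2012" "disputed"]
def AggAdm (adm : ∀ t, Set (L t) → Prop) (c : T → ℝ) (lv : ∀ t, Set (L t) → ℝ) (A : Set (∀ t, L t)) : Prop :=
  ∃ S : ∀ t, Set (L t), A = Set.univ.pi S ∧ (∀ t, (S t).Nonempty ∧ adm t (S t)) ∧
    (Function.support fun t => c t * lv t (S t)).Finite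

/-- On a box with nonempty factors the aggregated log-volume is `Σᶠ_t c_t · lv_t(S_t)`. [folklore] -/
theorem aggLogvol_pi (c : T → ℝ) (lv : ∀ t, Set (L t) → ℝ) (S : ∀ t, Set (L t))
    (hS : ∀ t, (S t).Nonempty) : aggLogvol c lv (Set.univ.pi S) = ∑ᶠ t, c t * lv t (S t) := by
  unfold aggLogvol
  congr 1
  funext t
  rw [Set.eval_image_univ_pi (Set.univ_pi_nonempty_iff.mpr hS)]

/-- **The assembled container axiom `logvol_mono`, PROVED**: nonnegative weights and factorwise-monotone
log-volumes give a monotone aggregated log-volume on admissible boxes. [folklore] -/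
theorem aggLogvol_mono {adm : ∀ t, Set (L t) → Prop} {c : T → ℝ} (hc : ∀ t, 0 ≤ c t)
    {lv : ∀ t, Set (L t) → ℝ}
    (hmono : ∀ t ⦃A B : Set (L t)⦄, adm t A → adm t B → A ⊆ B → lv t A ≤ lv t B)
    ⦃A B : Set (∀ t, L t)⦄ (hA : AggAdm adm c lv A) (hB : AggAdm adm c lv B) (hAB : A ⊆ B) :
    aggLogvol c lv A ≤ aggLogvol c lv B := by
  obtain ⟨SA, rfl, hSA, hfA⟩ := hA
  obtain ⟨SB, rfl, hSB, hfB⟩ := hB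
  rw [aggLogvol_pi c lv SA fun t => (hSA t).1, aggLogvol_pi c lv SB fun t => (hSB t).1]
  have hsub : ∀ t, SA t ⊆ SB t := by
    rcases Set.univ_pi_subset_univ_pi_iff.mp hAB with h | ⟨t, ht⟩
    · exact h
    · exact absurd ht (hSA t).1.ne_empty
  exact finsum_le_finsum' hfA hfB fun t =>
    mul_le_mul_of_nonneg_left (hmono t (hSA t).2 (hSB t).2 (hsub t)) (hc t)

open Literature.IUT.LogThetaLattice in
/-- **The aggregated log-volume IS the procession-normalized global log-volume of [IUTchIII] Prop. 3.9 BY NAME**: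
for `t = (j, v_ℚ) ∈ 𝔽_l^⋇ × 𝕍_ℚ` and `c_t = 1/l⋇`, on a box `Π_t S_t` it equals L6-t4's
`processionNormalized (j ↦ globalLogVolume (v_ℚ ↦ lv_{(j,v_ℚ)}) {S_{(j,v_ℚ)}}_{v_ℚ})` (Prop. 3.9 (i) p. 116 average over
`j`; (iii) p. 117 sum over `v_ℚ`; Cor. 3.12 p. 173 "the average is taken over `j ∈ 𝔽_l^⋇`").
[claim: Mochizuki2012, status: disputed] -/
theorem aggLogvol_pi_eq_processionNormalized {lstar : ℕ} {VQ : Type*} {Lp : Fin lstar × VQ → Type*}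
    (lv : ∀ t, Set (Lp t) → ℝ) (S : ∀ t, Set (Lp t)) (hS : ∀ t, (S t).Nonempty)
    (hfin : ∀ j : Fin lstar, (Function.support fun vQ => lv (j, vQ) (S (j, vQ))).Finite) :
    aggLogvol (fun _ => 1 / (lstar : ℝ)) lv (Set.univ.pi S) =
      processionNormalized fun j =>
        globalLogVolume (fun vQ => lv (j, vQ)) ⟨fun vQ => S (j, vQ), hfin j⟩ := by
  rw [aggLogvol_pi _ lv S hS, ← mul_finsum]
  have hsupp : (Function.support fun t : Fin lstar × VQ => lv t (S t)).Finite := by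
    refine (Set.finite_iUnion fun j : Fin lstar => (hfin j).image fun vQ => (j, vQ)).subset ?_
    rintro ⟨j, vQ⟩ ht
    exact Set.mem_iUnion.mpr ⟨j, ⟨vQ, ht, rfl⟩⟩
  rw [finsum_curry (fun t : Fin lstar × VQ => lv t (S t)) hsupp, finsum_eq_sum_of_fintype]
  unfold processionNormalized globalLogVolume
  rw [one_div, inv_mul_eq_div]

end Assemble

end Cor312Vol

end IUTFork

end Summit.ABC

end
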